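import Summits.BirchSwinnertonDyer.BirchSwinnertonDyer.Theorems.EisensteinPrimesAcTwistDeformationCurveStrictAtShapiro
import HarnessLib

/-!
# The Shapiro descent identifies the fullAt Selmer group `S_{𝓛_v}(K, 𝐃_E)` with Castella's PRIMITIVE `Sel_{v̄}(K_∞, E[p^∞])`
# (`selmerAc W p κ v̄ ∅`), `T ↦ conj_γ − 1`; a generic duality transport; hence `X_ac(E/K_∞)` HAS NO NON-ZERO FINITE `Λ`-SUBMODULE
# whenever `S_{𝓛_v}(K, 𝐃_E)` is almost divisible
# (cell `bsd-eis`, width seat `bsd-line-x2-p2` gen 7; helper for stmt-BirchSwinnertonDyer-19034; primitive twin of p653203, companion of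
# p654845 `…CurveFullAtAlmostDivisible`)

HONEST FRAMING (cell `bsd-eis`, run/shared/lean/pub/bsd-eis/): plumbing on constructed objects; no definition, no named fact, no `sorry`,
no `Theses` import; nothing about BSD or a main conjecture is asserted; nothing booked; no label or count moves. Helper `--supports
stmt-BirchSwinnertonDyer-19034`; closes no stub. UNCONDITIONAL (almost-divisibility is an INPUT; its published-fact price is p654845).

## What

* §1 (generic in the specification `L` and the imprimitivity set `S'`) **`xAc_hasNoPseudoNullSubmodule_of_bijective`**,
  **`xAc_eq_bot_of_finite_of_bijective`**, **`xAc_eq_zero_of_smul_eq_zero_of_bijective`** — given ANY bijective additive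
  `φ : S_L(K, 𝐃_E) → selmerAc W p κ v̄ S'` with `φ (T • s) = (conj_γ − 1)(φ s)`: `IsAlmostDivisible Λ S_L` ⟹ `XAc W p κ v̄ S' γ` has no
  non-zero pseudo-null submodule ⟹ every finite `Λ`-submodule is `⊥` ⟹ (f.g., torsion, `μ = 0`) no `p`-torsion. (p653203 §3 is the
  instance `L = 𝓛^{v̄}`, `S' = Sf`; the proofs are the same: Castella's dual pair `XAc.isDualPair` + `isDualPair_characterModule_selmer`
  give a `Λ`-linear bijection `XAc ≅ CharacterModule S_L`.)
* §2 (the fullAt specification `𝓛_v = fullAtSpecification S 𝐃_E (inr v)`, data as in x1-w3 g3's `…CurveCotorsion`: `K` totally complex,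
  `p = v v̄` the only places of `S` above `p`, `W` good off `S ∪ {w ∣ p}`) `shapiroDescent_mem_selmerAc_empty_of_mem_fullAtSelmer` (INTO —
  x1-w3 g3's argument, exposed as a theorem), `exists_mem_fullAtSelmer_shapiroDescent_eq_of_mem_selmerAc_empty` (ONTO — p652003's
  `exists_shapiroDescent_eq_of_mem_unramifiedOutside` + the converse dictionary at EVERY `w ∈ Σ ∖ {v}`: strict at `v̄`, locally trivial
  at `w ∈ S`, `w ∤ p`, `H¹(ℂ, ·) = 0`), **`exists_addMonoidHom_fullAtSelmer_bijective`**.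

References: [Greenberg2006] Thm. 3 p. 342; [Castella2018] Def. 2.2; [GreenbergLNM1716] §1 p. 60; [Greenberg2016Selmer] §1 p. 2;
[Washington1997] §13.2; [CastellaGrossiLeeSkinner2022] Cor. 1.4.3; [KellerYin2024] §1.4 (e).
-/

set_option autoImplicit false
set_option linter.dupNamespace false -- the summit namespace `…BirchSwinnertonDyer.BirchSwinnertonDyer.Theorems` (Sub = Summit, D-0017) trips it

noncomputable section

open scoped Classical
open NumberField IsDedekindDomain Field PowerSeries
open Literature.NumberTheory.EllipticCurves Literature.NumberTheory.EllipticCurves.GreenbergSelmer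
  Literature.NumberTheory.EllipticCurves.GreenbergVatsal2000 Literature.NumberTheory.GaloisRepresentations
  Literature.NumberTheory.EllipticCurves.IwasawaDual Literature.NumberTheory.EllipticCurves.Castella2018.AcSelmer
  Literature.NumberTheory.IwasawaTheory Literature.NumberTheory.IwasawaTheory.Greenberg2016
  Literature.NumberTheory.IwasawaTheory.Greenberg2006
  Summit.BirchSwinnertonDyer.BirchSwinnertonDyer.Theorems.GreenbergFullAtSelmer

namespace Summit.BirchSwinnertonDyer.BirchSwinnertonDyer.Theorems.AcTwistDeformation

/-! ## §1 Generic duality transport along a bijective oriented `φ : S_L → selmerAc … S'` -/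

section Transport

variable {K : Type} [Field K] [NumberField K] (S : Set (HeightOneSpectrum (𝓞 K))) {p : ℕ} [Fact p.Prime]
  (W : WeierstrassCurve K) [W.IsElliptic]
  [TopologicalSpace (PowerSeries ℤ_[p])] [IsTopologicalRing (PowerSeries ℤ_[p])]
  [IsTopologicalAddGroup (BigRepModule ℤ_[p] p (PrimaryTorsion W.geomPoints p))]
  [ContinuousSMul (PowerSeries ℤ_[p]) (BigRepModule ℤ_[p] p (PrimaryTorsion W.geomPoints p))]
  (hS : ∀ v : HeightOneSpectrum (𝓞 K), ((p : ℕ) : 𝓞 K) ∈ v.asIdeal → v ∈ S)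
  (κ : ZpExtension K p)
  (ρ₀ : ContinuousRep (GaloisGroupUnramifiedOutside K S) ℤ_[p] (PrimaryTorsion W.geomPoints p))
  (vbar : HeightOneSpectrum (𝓞 K)) (S' : Set (HeightOneSpectrum (𝓞 K)))
  {γ : absoluteGaloisGroup K} [Fact (κ.IsTopGenerator γ)]
  (L : Specification S (bigRep (κ.liftUnramifiedOutside S hS) ρ₀))
  (φ : L.selmer →+ selmerAc W p κ vbar S') (hφbij : Function.Bijective φ)
  (hφ : ∀ s : L.selmer, φ (DistribSMul.toAddMonoidHom L.selmer (PowerSeries.X : PowerSeries ℤ_[p]) s) =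
    (conjSelmerAc W p κ vbar S' γ - 1) (φ s))

omit [W.IsElliptic] [IsTopologicalRing (PowerSeries ℤ_[p])]
  [IsTopologicalAddGroup (BigRepModule ℤ_[p] p (PrimaryTorsion W.geomPoints p))] in
include hφbij hφ in
/-- **`XAc W p κ v̄ S' γ` is a balanced Pontryagin dual of `S_L(K, 𝐃_E)` along any bijective oriented `φ` ⟹ no non-zero pseudo-null
submodule when `S_L` is almost divisible**: `G x = x ∘ φ` is a `Λ`-linear bijection onto `CharacterModule S_L`
(`IwasawaDual.IsDualPair.exists_linearMap_comp_surjective`, `injective_of_toDual_comp`), hence `IsDualPairing Λ S_L G`.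
[cite: Greenberg2016Selmer, §1 p. 2 L17–35] [cite: GreenbergLNM1716, §1 p. 60] -/
theorem xAc_hasNoPseudoNullSubmodule_of_bijective (hAD : IsAlmostDivisible (PowerSeries ℤ_[p]) L.selmer) :
    HasNoPseudoNullSubmodule (PowerSeries ℤ_[p]) (XAc W p κ vbar S' γ) := by
  have h := XAc.isDualPair W p κ vbar S' γ
  have h' := isDualPair_characterModule_selmer S hS κ ρ₀ L
  obtain ⟨G, hGsurj, hG⟩ := h.exists_linearMap_comp_surjective h' φ hφ hφbij.1
  have hGinj : Function.Injective G := h.injective_of_toDual_comp φ hφbij.2 hG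
  have hpair : IsDualPairing (PowerSeries ℤ_[p]) L.selmer
      (G.toAddMonoidHom : XAc W p κ vbar S' γ →+ (L.selmer →+ AddCircle (1 : ℚ))) :=
    { bijective := ⟨hGinj, hGsurj⟩
      map_smul := fun r x s ↦ by
        change G (r • x) s = G x (r • s)
        rw [map_smul]
        exact (isDualPairing_characterModule (PowerSeries ℤ_[p]) L.selmer).map_smul r (G x) s }
  exact hAD (XAc W p κ vbar S' γ) G.toAddMonoidHom hpair

omit [W.IsElliptic] [IsTopologicalRing (PowerSeries ℤ_[p])]
  [IsTopologicalAddGroup (BigRepModule ℤ_[p] p (PrimaryTorsion W.geomPoints p))] in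
include hφbij hφ in
/-- **Every FINITE `Λ`-submodule of `XAc W p κ v̄ S' γ` is `⊥`** when `S_L(K, 𝐃_E) ≅ selmerAc … S'` is almost divisible (finite ⟹
pseudo-null over `ℤ_p⟦T⟧`, `isPseudoNull_of_finite`). [cite: CastellaGrossiLeeSkinner2022, Cor. 1.4.3] [cite: NeukirchSchmidtWingberg2008, Ch. V §1 (5.1.4) Remark 4] -/
theorem xAc_eq_bot_of_finite_of_bijective (hAD : IsAlmostDivisible (PowerSeries ℤ_[p]) L.selmer)
    (N : Submodule (IwasawaAlgebra p) (XAc W p κ vbar S' γ)) (hN : Finite N) : N = ⊥ :=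
  xAc_hasNoPseudoNullSubmodule_of_bijective S W hS κ ρ₀ vbar S' L φ hφbij hφ hAD N
    (Literature.NumberTheory.EllipticCurves.isPseudoNull_of_finite p N)

omit [W.IsElliptic] [IsTopologicalRing (PowerSeries ℤ_[p])]
  [IsTopologicalAddGroup (BigRepModule ℤ_[p] p (PrimaryTorsion W.geomPoints p))] in
include hφbij hφ in
/-- **`XAc W p κ v̄ S' γ` has no `p`-torsion** when finitely generated, `Λ`-torsion with `μ = 0` and `S_L(K, 𝐃_E) ≅ selmerAc … S'` is almost
divisible (`IwasawaAlgebra.eq_zero_of_C_p_smul_eq_zero_of_muInvariant_eq_zero`). [cite: Washington1997, §13.2] [cite: CastellaGrossiLeeSkinner2022, Cor. 1.4.3] -/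
theorem xAc_eq_zero_of_smul_eq_zero_of_bijective (hAD : IsAlmostDivisible (PowerSeries ℤ_[p]) L.selmer)
    (hXfin : Module.Finite (IwasawaAlgebra p) (XAc W p κ vbar S' γ))
    (hXtor : Module.IsTorsion (IwasawaAlgebra p) (XAc W p κ vbar S' γ))
    (hμ : muInvariant p (XAc W p κ vbar S' γ) = 0)
    (x : XAc W p κ vbar S' γ) (hx : p • x = 0) : x = 0 := by
  letI : Module ℤ_[p] (XAc W p κ vbar S' γ) := Module.compHom _ (algebraMap ℤ_[p] (IwasawaAlgebra p))
  haveI : IsScalarTower ℤ_[p] (IwasawaAlgebra p) (XAc W p κ vbar S' γ) := IsScalarTower.of_compHom ℤ_[p] _ _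
  haveI := hXfin
  refine IwasawaAlgebra.eq_zero_of_C_p_smul_eq_zero_of_muInvariant_eq_zero (p := p) (M := XAc W p κ vbar S' γ) hXtor
    (fun N hN ↦ xAc_eq_bot_of_finite_of_bijective S W hS κ ρ₀ vbar S' L φ hφbij hφ hAD N hN) hμ ?_
  rw [map_natCast, Nat.cast_smul_eq_nsmul]
  exact hx

end Transport

/-! ## §2 The fullAt specification: INTO, ONTO, bijection onto the PRIMITIVE `selmerAc W p κ v̄ ∅` -/

section CurveFullAt

variable {K : Type} [Field K] [NumberField K] (S : Set (HeightOneSpectrum (𝓞 K))) {p : ℕ} [Fact p.Prime]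
  (W : WeierstrassCurve K) [W.IsElliptic]
  [TopologicalSpace (PowerSeries ℤ_[p])] [IsTopologicalRing (PowerSeries ℤ_[p])]
  [IsTopologicalAddGroup (BigRepModule ℤ_[p] p (PrimaryTorsion W.geomPoints p))]
  [ContinuousSMul (PowerSeries ℤ_[p]) (BigRepModule ℤ_[p] p (PrimaryTorsion W.geomPoints p))]
  (hS : ∀ v : HeightOneSpectrum (𝓞 K), ((p : ℕ) : 𝓞 K) ∈ v.asIdeal → v ∈ S)
  (κ : ZpExtension K p)
  (ρ₀ : ContinuousRep (GaloisGroupUnramifiedOutside K S) ℤ_[p] (PrimaryTorsion W.geomPoints p))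
  (hρ₀ : ∀ (σ : absoluteGaloisGroup K) (P : PrimaryTorsion W.geomPoints p), ρ₀ (toUnramifiedQuot K S σ) P = σ • P)
  (hKc : ∀ w : InfinitePlace K, w.IsComplex)
  {v vbar : HeightOneSpectrum (𝓞 K)} (hv : ((p : ℕ) : 𝓞 K) ∈ v.asIdeal) (hvbar : ((p : ℕ) : 𝓞 K) ∈ vbar.asIdeal) (hne : vbar ≠ v)
  (hSp : ∀ w : HeightOneSpectrum (𝓞 K), w ∈ S → ((p : ℕ) : 𝓞 K) ∈ w.asIdeal → w = v ∨ w = vbar)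
  (hgood : ∀ w : HeightOneSpectrum (𝓞 K), w ∉ S → ((p : ℕ) : 𝓞 K) ∉ w.asIdeal → W.HasGoodReductionAt w)
  {F : (bigRep (κ.liftUnramifiedOutside S hS) ρ₀).H 1 →+ W.subgroupH1 p κ.kerSubgroup}
  (hF : ∀ (c : contOneCocycles (bigRep (κ.liftUnramifiedOutside S hS) ρ₀).toTopRep)
    (z : contOneCocycles (discreteTopRep κ.kerSubgroup (W.geomPrimaryTorsion p))),
    (∀ h : κ.kerSubgroup, z.1 h = (AddEquiv.refl _ : PrimaryTorsion W.geomPoints p ≃+ W.geomPrimaryTorsion p)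
      ((c.1 (toUnramifiedQuot K S h) : BigRepModule ℤ_[p] p (PrimaryTorsion W.geomPoints p)) 0)) →
    F (oneCocycleClass _ c) = oneCocycleClass _ z)

include hρ₀ hKc hv hvbar hne hgood hF in
/-- **INTO** (x1-w3 g3's argument of `hasCorank_fullAtSelmer_zero_of_xAc`, exposed): for `ξ ∈ S_{𝓛_v}(K, 𝐃_E)` (`loc_w ξ = 0` at every
`w ∈ Σ ∖ {v}`), `F ξ ∈ selmerAc W p κ v̄ ∅` — locally trivial at `w ∈ S`, `w ∤ p` (dictionary), at the good `w ∉ S` (unramified ⟹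
trivial), strict at `v̄`, no archimedean condition. [cite: Castella2018, Def. 2.2 (arXiv:1704.06608 p. 5)] [cite: Greenberg2006, Thm. 3 p. 342] -/
theorem shapiroDescent_mem_selmerAc_empty_of_mem_fullAtSelmer
    (c : contOneCocycles (bigRep (κ.liftUnramifiedOutside S hS) ρ₀).toTopRep)
    (hξ : oneCocycleClass _ c ∈ (fullAtSpecification S (bigRep (κ.liftUnramifiedOutside S hS) ρ₀) (Sum.inr v)).selmer) :
    F (oneCocycleClass _ c) ∈ selmerAc W p κ vbar (∅ : Set (HeightOneSpectrum (𝓞 K))) := by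
  let ψ : PrimaryTorsion W.geomPoints p ≃+ W.geomPrimaryTorsion p := AddEquiv.refl _
  have hψ : ∀ (σ : absoluteGaloisGroup K) (a : PrimaryTorsion W.geomPoints p),
      ψ (ρ₀ (toUnramifiedQuot K S σ) a) = σ • ψ a := fun σ a ↦ by rw [hρ₀]; rfl
  have hA : ∀ a : PrimaryTorsion W.geomPoints p, ∃ k : ℕ, p ^ k • a = 0 := fun a ↦ by
    obtain ⟨k, hk⟩ := a.exists_pow_smul_eq_zero
    exact ⟨k, PrimaryTorsion.ext (by rw [PrimaryTorsion.val_nsmul]; exact hk)⟩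
  have hM : ∀ m : W.geomPrimaryTorsion p, ∃ k : ℕ, p ^ k • m = 0 := fun m ↦ hA m
  have hstab : ∀ m : W.geomPrimaryTorsion p,
      IsOpen (MulAction.stabilizer (absoluteGaloisGroup K) m : Set (absoluteGaloisGroup K)) :=
    AcSigned.isOpen_stabilizer_geomPrimaryTorsion W
  have hξ' := (mem_selmer_fullAtSpecification_iff (Sum.inr v) _).mp hξ
  have hloc : ∀ w : HeightOneSpectrum (𝓞 K), w ∈ S → w ≠ v →
      loc S (bigRep (κ.liftUnramifiedOutside S hS) ρ₀) (Sum.inr w) 1 (oneCocycleClass _ c) = 0 :=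
    fun w hw hwv ↦ hξ' ⟨Sum.inr w, (inSigma_inr_iff S w).mpr hw⟩ (fun e ↦ hwv (Sum.inr_injective e))
  change F (oneCocycleClass _ c) ∈ selmerOver κ.kerSubgroup (W.geomPrimaryTorsion p) p vbar ∅
  rw [mem_selmerOver_iff]
  refine ⟨fun w hpw _ σ ↦ ?_, fun w σ ↦ ?_, fun σ ↦ ?_⟩
  · by_cases hwS : w ∈ S
    · have hwv : w ≠ v := fun e ↦ hpw (e ▸ hv)
      exact conjH1_shapiroDescent_mem_awayKer_of_loc_eq_zero S hS κ ρ₀ ψ hψ hA hF w c (hloc w hwS hwv) σ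
    · have hunr := conjH1_shapiroDescent_mem_unramifiedKer_of_not_mem S hS κ ρ₀ ψ hψ hF hwS c σ
      by_cases hD : decomp (K := K) w ≤ κ.kerSubgroup
      · exact UniversalToricDescentTwistedDescent.unramifiedKer_le_awayKer_kerSubgroup_of_decomp_le W p κ
          hpw (hgood w hwS hpw) hD hunr
      · exact UnramifiedLeAwayKer.unramifiedKer_le_awayKer_of_not_decomp_le (κ := κ) hstab hM
          (IwasawaTwoVariable.inertia_le_kerSubgroup_of_not_mem κ hpw) hD hunr
  · exact Summit.BirchSwinnertonDyer.Rank1Residual.X11b.Coinv.mem_infKer_of_decompInf_eq_bot w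
      (BigGaloisRep.decompInf_eq_bot_of_isComplex (hKc w)) _
  · rw [Literature.NumberTheory.EllipticCurves.BigGaloisRep.strictKer_strictDatum_eq_awayKer]
    exact conjH1_shapiroDescent_mem_awayKer_of_loc_eq_zero S hS κ ρ₀ ψ hψ hA hF vbar c (hloc vbar (hS vbar hvbar) hne) σ

omit [W.IsElliptic] in
include hρ₀ hKc hSp hF in
/-- **ONTO**: every class of the PRIMITIVE `selmerAc W p κ v̄ ∅` is `F[c]` with `[c] ∈ S_{𝓛_v}(K, 𝐃_E)` — unramified outside `S` gives `c`
(p652003), and `loc_w[c] = 0` at every `w ∈ Σ ∖ {v}`: at `v̄` from the strict condition, at `w ∈ S` with `w ∤ p` from local triviality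
(both by the converse dictionary), at the complex archimedean places because `H¹(ℂ, ·) = 0`.
[cite: Castella2018, Def. 2.2 (arXiv:1704.06608 p. 5)] [cite: Greenberg2006, Thm. 3 p. 342] -/
theorem exists_mem_fullAtSelmer_shapiroDescent_eq_of_mem_selmerAc_empty
    (y : W.subgroupH1 p κ.kerSubgroup) (hy : y ∈ selmerAc W p κ vbar (∅ : Set (HeightOneSpectrum (𝓞 K)))) :
    ∃ c : contOneCocycles (bigRep (κ.liftUnramifiedOutside S hS) ρ₀).toTopRep,
      oneCocycleClass _ c ∈ (fullAtSpecification S (bigRep (κ.liftUnramifiedOutside S hS) ρ₀) (Sum.inr v)).selmer ∧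
        F (oneCocycleClass _ c) = y := by
  let ψ : PrimaryTorsion W.geomPoints p ≃+ W.geomPrimaryTorsion p := AddEquiv.refl _
  have hψ : ∀ (σ : absoluteGaloisGroup K) (a : PrimaryTorsion W.geomPoints p),
      ψ (ρ₀ (toUnramifiedQuot K S σ) a) = σ • ψ a := fun σ a ↦ by rw [hρ₀]; rfl
  have hA : ∀ a : PrimaryTorsion W.geomPoints p, ∃ k : ℕ, p ^ k • a = 0 := fun a ↦ by
    obtain ⟨k, hk⟩ := a.exists_pow_smul_eq_zero
    exact ⟨k, PrimaryTorsion.ext (by rw [PrimaryTorsion.val_nsmul]; exact hk)⟩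
  have hy' := hy
  change y ∈ selmerOver κ.kerSubgroup (W.geomPrimaryTorsion p) p vbar ∅ at hy'
  rw [mem_selmerOver_iff] at hy'
  have hunr : y ∈ GreenbergVatsal2000.unramifiedOutside κ.kerSubgroup (W.geomPrimaryTorsion p) p S := by
    rw [GreenbergVatsal2000.mem_unramifiedOutside_iff]
    intro w _ hpw σ
    exact awayKer_le_unramifiedKer (M := W.geomPrimaryTorsion p) κ.kerSubgroup w
      (hy'.1 w hpw (Set.notMem_empty w) σ)
  obtain ⟨ξ, hξ⟩ := exists_shapiroDescent_eq_of_mem_unramifiedOutside S hS κ ρ₀ ψ hψ hA hF y hunr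
  obtain ⟨c, rfl⟩ := oneCocycleClass_surjective _ ξ
  refine ⟨c, (mem_selmer_fullAtSpecification_iff (Sum.inr v) _).mpr ?_, hξ⟩
  rintro ⟨w | w, hwS0⟩ hwv
  · -- complex archimedean place: `H¹ = 0`
    haveI := subsingleton_localH1_inl_of_isComplex S (bigRep (κ.liftUnramifiedOutside S hS) ρ₀) (hKc w)
    exact Subsingleton.elim _ _
  · have hwS : w ∈ S := (inSigma_inr_iff S w).mp hwS0
    have hwv' : w ≠ v := fun e ↦ hwv (show (Sum.inr w : Place K) = Sum.inr v by rw [e])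
    refine loc_eq_zero_of_forall_conjH1_shapiroDescent_mem_awayKer S hS κ ρ₀ ψ hψ hA hF w c fun σ ↦ ?_
    rw [hξ]
    by_cases hpw : ((p : ℕ) : 𝓞 K) ∈ w.asIdeal
    · -- `w ∣ p`, `w ≠ v`: `w = v̄`, the strict condition
      rcases hSp w hwS hpw with h | h
      · exact absurd h hwv'
      · subst h
        rw [← Literature.NumberTheory.EllipticCurves.BigGaloisRep.strictKer_strictDatum_eq_awayKer]
        exact hy'.2.2 σ
    · exact hy'.1 w hpw (Set.notMem_empty w) σ

include hρ₀ hKc hv hvbar hne hSp hgood hF in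
/-- **`S_{𝓛_v}(K, 𝐃_E) ≅ selmerAc W p κ v̄ ∅` as abelian groups, `T ↦ conj_γ − 1`** (bijective additive `φ`, `φ s = F s`).
[cite: Greenberg2006, Thm. 3 p. 342 ("as `Λ`-modules")] [cite: Castella2018, §2.2 Def. 2.2] -/
theorem exists_addMonoidHom_fullAtSelmer_bijective {γ : absoluteGaloisGroup K} [hγ : Fact (κ.IsTopGenerator γ)] :
    ∃ φ : (fullAtSpecification S (bigRep (κ.liftUnramifiedOutside S hS) ρ₀) (Sum.inr v)).selmer →+
        selmerAc W p κ vbar (∅ : Set (HeightOneSpectrum (𝓞 K))), Function.Bijective φ ∧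
      (∀ s, ((φ s : selmerAc W p κ vbar (∅ : Set (HeightOneSpectrum (𝓞 K)))) : W.subgroupH1 p κ.kerSubgroup) =
        F (s : (bigRep (κ.liftUnramifiedOutside S hS) ρ₀).H 1)) ∧
      ∀ s, φ (DistribSMul.toAddMonoidHom _ (PowerSeries.X : PowerSeries ℤ_[p]) s) =
        (conjSelmerAc W p κ vbar (∅ : Set (HeightOneSpectrum (𝓞 K))) γ - 1) (φ s) := by
  let ψ : PrimaryTorsion W.geomPoints p ≃+ W.geomPrimaryTorsion p := AddEquiv.refl _
  have hψ : ∀ (σ : absoluteGaloisGroup K) (a : PrimaryTorsion W.geomPoints p),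
      ψ (ρ₀ (toUnramifiedQuot K S σ) a) = σ • ψ a := fun σ a ↦ by rw [hρ₀]; rfl
  have hA : ∀ a : PrimaryTorsion W.geomPoints p, ∃ k : ℕ, p ^ k • a = 0 := fun a ↦ by
    obtain ⟨k, hk⟩ := a.exists_pow_smul_eq_zero
    exact ⟨k, PrimaryTorsion.ext (by rw [PrimaryTorsion.val_nsmul]; exact hk)⟩
  set L := fullAtSpecification S (bigRep (κ.liftUnramifiedOutside S hS) ρ₀) (Sum.inr v) with hLdef
  have hmem : ∀ s : L.selmer, F (s : (bigRep (κ.liftUnramifiedOutside S hS) ρ₀).H 1) ∈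
      selmerAc W p κ vbar (∅ : Set (HeightOneSpectrum (𝓞 K))) := by
    rintro ⟨ξ, hξ⟩
    obtain ⟨c, rfl⟩ := oneCocycleClass_surjective _ ξ
    exact shapiroDescent_mem_selmerAc_empty_of_mem_fullAtSelmer S W hS κ ρ₀ hρ₀ hKc hv hvbar hne hgood hF c hξ
  let φ : L.selmer →+ selmerAc W p κ vbar (∅ : Set (HeightOneSpectrum (𝓞 K))) :=
    { toFun := fun s ↦ ⟨F s, hmem s⟩
      map_zero' := Subtype.ext (by simp)
      map_add' := fun s t ↦ Subtype.ext (by simp) }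
  refine ⟨φ, ⟨?_, ?_⟩, fun s ↦ rfl, fun s ↦ ?_⟩
  · refine (injective_iff_map_eq_zero φ).2 fun s hs ↦ ?_
    have h0 : F (s : (bigRep (κ.liftUnramifiedOutside S hS) ρ₀).H 1) = 0 := congrArg Subtype.val hs
    obtain ⟨c, hc⟩ := oneCocycleClass_surjective _ (s : (bigRep (κ.liftUnramifiedOutside S hS) ρ₀).H 1)
    rw [← hc] at h0
    exact Subtype.ext (hc.symm.trans
      (oneCocycleClass_eq_zero_of_shapiroDescent_eq_zero S hS κ ρ₀ ψ hψ hA hF c h0))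
  · rintro ⟨y, hy⟩
    obtain ⟨c, hcmem, hcy⟩ := exists_mem_fullAtSelmer_shapiroDescent_eq_of_mem_selmerAc_empty S W hS κ ρ₀ hρ₀ hKc hSp hF
      y hy
    exact ⟨⟨oneCocycleClass _ c, hcmem⟩, Subtype.ext hcy⟩
  · apply Subtype.ext
    change F ((PowerSeries.X : PowerSeries ℤ_[p]) • (s : (bigRep (κ.liftUnramifiedOutside S hS) ρ₀).H 1)) =
      W.conjH1 p κ.kerSubgroup γ (F s) - F s
    exact shapiroDescent_X_smul S hS κ ρ₀ ψ hψ hF hγ.out _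

end CurveFullAt

end Summit.BirchSwinnertonDyer.BirchSwinnertonDyer.Theorems.AcTwistDeformation

end
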